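import Mathlib
import HarnessLib
import Summits.ValiantsHypothesis.ValiantsHypothesis.Theses.ChowBorderDepth3

/-!
# Route ChowBorderDepth3 — glue `ChowToThesis`

`ChowBorderBound → SPSNormalForm → Depth3Thesis` (item stmt-ValiantsHypothesis-5940).

Given `c`, take `n := n₀` from `ChowBorderBound` at exponent parameter `c + 1`.  If a
product-depth-≤1 circuit `P` computing `per_n` had at most `(n+2)^(c⌊√n⌋+c)` wires, then
`SPSNormalForm` writes `per_n = Σ_{i ≤ E} Π_{j ≤ E} ℓ_ij` exactly with affine `ℓ_ij` over `ℂ`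
(`E = P.edgeSize`).  Base-changing along `Polynomial.C : ℂ → ℂ[ε]` gives a border expression with
`q = 0`, `G = 0`, and `E + 1 ≤ (n+2)^((c+1)⌊√n⌋ + (c+1))`, contradicting `ChowBorderBound`.
-/

set_option linter.dupNamespace false

namespace Summit.ValiantsHypothesis.ValiantsHypothesis.Theorems

open Summit.ValiantsHypothesis.ValiantsHypothesis.Theses.ChowBorderDepth3

/-- Arithmetic bookkeeping: `E ≤ (n+2)^(c⌊√n⌋+c)` forces `E + 1 ≤ (n+2)^((c+1)⌊√n⌋+(c+1))`. -/
theorem chowToThesis_succ_le_pow {n c E : ℕ} (hE : E ≤ (n + 2) ^ (c * Nat.sqrt n + c)) :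
    E + 1 ≤ (n + 2) ^ ((c + 1) * Nat.sqrt n + (c + 1)) := by
  have h1 : 1 ≤ (n + 2) ^ (c * Nat.sqrt n + c) := Nat.one_le_pow _ _ (by omega)
  have h2 : (n + 2) ^ (c * Nat.sqrt n + c) * 2 ≤ (n + 2) ^ ((c + 1) * Nat.sqrt n + (c + 1)) := by
    calc (n + 2) ^ (c * Nat.sqrt n + c) * 2
        ≤ (n + 2) ^ (c * Nat.sqrt n + c) * (n + 2) ^ (Nat.sqrt n + 1) := by
          apply Nat.mul_le_mul_left
          calc 2 ≤ n + 2 := by omega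
            _ = (n + 2) ^ 1 := (pow_one _).symm
            _ ≤ (n + 2) ^ (Nat.sqrt n + 1) := Nat.pow_le_pow_right (by omega) (by omega)
      _ = (n + 2) ^ ((c + 1) * Nat.sqrt n + (c + 1)) := by
          rw [← pow_add]; congr 1; ring
  omega

/-- **Glue `ChowToThesis`** (item stmt-ValiantsHypothesis-5940): the border Chow-rank bound for the
padded permanent together with the ΣΠΣ normal form of product-depth-≤1 circuits implies the
depth-three thesis.  Take `c + 1` in `ChowBorderBound`, embed the exact expression over `ℂ[ε]`
with `q = 0`, `G = 0`. -/
theorem chowToThesis_proof : ChowToThesis := by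
  unfold ChowToThesis
  intro hChow hNF c
  obtain ⟨n₀, hn₀⟩ := hChow (c + 1)
  refine ⟨n₀, fun P hP hdepth => ?_⟩
  by_contra hlt
  have hE : P.edgeSize ≤ (n₀ + 2) ^ (c * Nat.sqrt n₀ + c) := not_lt.mp hlt
  obtain ⟨ℓ, hℓdeg, hℓsum⟩ := hNF n₀ P hP hdepth
  have hbound := chowToThesis_succ_le_pow hE
  refine hn₀ n₀ le_rfl (P.edgeSize + 1) (P.edgeSize + 1) hbound hbound
    ⟨0, fun i j => MvPolynomial.map Polynomial.C (ℓ i j), 0, ?_, ?_⟩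
  · intro i j
    exact (Finset.sup_mono (MvPolynomial.support_map_subset _ _)).trans (hℓdeg i j)
  · have hmap : (∑ i, ∏ j, MvPolynomial.map Polynomial.C (ℓ i j)) =
        MvPolynomial.map (σ := Fin n₀ × Fin n₀) Polynomial.C (∑ i, ∏ j, ℓ i j) := by
      simp only [map_sum, map_prod]
    rw [hmap, hℓsum]
    simp
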